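import Mathlib
import HarnessLib

/-!
# [telescope — width x2-p2 g25, 2026-08-30] Brick G2 (algebra) of «(F) CONSTRUCTED IN TREE»: reducibility from a vanishing
off-diagonal, and rigidity of the trace pairing

Crux 4 `BSDpOnCellC` (stmt-BirchSwinnertonDyer-19034), line «telescope» v19; the ʳ-chain (director (610), host map
STATUS l.7169/l.7171, ownership word l.7197, collision ruling l.7199) constructs the Frobenius-currency Galois lattice of T-An-2ᶠ
(`Literature.NumberTheory.EllipticCurves.hida1986_castella2020_exists_frobeniusGaloisLattice_on_pNewBranchChart`) in the
tree by Wiles' method (Invent. Math. 94 (1988) §2.2): interpolate the traces of the members' representations along the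
chart into a Wiles pseudo-representation `{a, d, x}` of `(Γ_ℚ, c)` over `ℤ_p⟦X⟧`, turn it into a representation over
`Frac ℤ_p⟦X⟧`, and frame an integral lattice. The `c`-adapted frames (odd involutions ~ `diag(−1,1)`) are Literature-side
(idea-12 g44's `WilesPseudoRepresentationAdaptedBasis`, host ruling l.7199); this file supplies the two remaining pieces of PURE
MATRIX ALGEBRA the chain consumes (no Galois theory, no power series):

* §1 `not_isIrreducible_of_forall_apply_eq_smul` and the matrix corollary `not_isIrreducible_of_offDiag_mul_eq_zero` /
  `exists_offDiag_mul_ne_zero_of_isIrreducible` — a two-dimensional representation all of whose matrices satisfy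
  `ρ(r)₀₁ · ρ(s)₁₀ = 0` has a stable coordinate line, hence is NOT irreducible (the non-degeneracy «`x ≢ 0`» of Wiles' triple
  at an irreducible fibre — G2c of the LEAD's RCHAIN-SPEC §4, to be fed p776189 at `X = 0`);
* §2 `eq_one_of_forall_trace_mul_eq` — if the matrices `ρ(g)` SPAN `Mₙ(A)` and `tr(ρ(g) M) = tr(ρ(g))` for all `g`, then
  `M = 1` (non-degeneracy of the trace pairing: the unramifiedness transfer «`T(σι) = T(σ) ∀σ ⇒ π(ι) = 1`», RCHAIN-SPEC §6
  G5a), with `span_range_eq_top_of_adjoin_eq_top` (for a monoid homomorphism, «generates `Mₙ(A)` as an algebra» = «spans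
  `Mₙ(A)`», so that B1's `WilesPseudoRep.adjoin_range_toRep_eq_top` feeds it) and `map_eq_one_of_forall_trace_mul_eq`.

Helper toward crux 4 (`--supports`); it closes NO registered stub, changes no registered token, proves no cited fact
and no summit statement; BSD is proved for no curve.
-/

set_option autoImplicit false
set_option linter.dupNamespace false

open Matrix

namespace Summit.BirchSwinnertonDyer.BirchSwinnertonDyer.Theorems.TelescopeBranchWilesRepAlgebra

/-! ### §1. A common eigenvector makes a representation reducible -/

section Reducible

variable {K : Type*} [Field K] {G : Type*} [Monoid G] {V : Type*} [AddCommGroup V] [Module K V]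

/-- **A representation with a stable line which is not everything is not irreducible**: if `v ≠ 0`, `K ∙ v ≠ V` and every
`ρ(g)` maps `v` to a multiple of `v`, then `K ∙ v` is a proper non-zero subrepresentation. [folklore] -/
theorem not_isIrreducible_of_forall_apply_eq_smul (ρ : Representation K G V) (v : V) (hv : v ≠ 0)
    (htop : (K ∙ v) ≠ ⊤) (h : ∀ g, ∃ a : K, ρ g v = a • v) : ¬ ρ.IsIrreducible := by
  intro hirr
  let S : Subrepresentation ρ :=
    { toSubmodule := K ∙ v
      apply_mem_toSubmodule := fun g w hw => by
        obtain ⟨b, rfl⟩ := Submodule.mem_span_singleton.mp hw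
        obtain ⟨a, ha⟩ := h g
        rw [map_smul, ha, smul_smul]
        exact Submodule.mem_span_singleton.mpr ⟨b * a, rfl⟩ }
  rcases hirr.eq_bot_or_eq_top S with hS | hS
  · have hvS : v ∈ S.toSubmodule := Submodule.mem_span_singleton_self v
    rw [hS] at hvS
    exact hv ((Submodule.mem_bot K).mp hvS)
  · exact htop (congrArg Subrepresentation.toSubmodule hS)

/-- In `K²` a coordinate vector does not span everything. [folklore] -/
theorem span_single_ne_top (i : Fin 2) : (K ∙ (Pi.single i (1 : K) : Fin 2 → K)) ≠ ⊤ := by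
  intro h
  obtain ⟨j, hj⟩ : ∃ j : Fin 2, j ≠ i := ⟨i + 1, by fin_cases i <;> decide⟩
  have hmem : (Pi.single j (1 : K) : Fin 2 → K) ∈ K ∙ (Pi.single i (1 : K) : Fin 2 → K) := by
    rw [h]; exact Submodule.mem_top
  obtain ⟨a, ha⟩ := Submodule.mem_span_singleton.mp hmem
  have := congrFun ha j
  simp [hj] at this

/-- **Matrix form (upper-right entries vanish).** If a representation `σ` of `G` on `K²` acts through matrices `ρ(g)` with
`ρ(g)₀₁ = 0` for all `g`, then `e₂` is a common eigenvector and `σ` is not irreducible. [folklore] -/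
theorem not_isIrreducible_of_apply_zero_one_eq_zero (σ : Representation K G (Fin 2 → K))
    (ρ : G → Matrix (Fin 2) (Fin 2) K) (hσ : ∀ g v, σ g v = ρ g *ᵥ v) (h : ∀ g, ρ g 0 1 = 0) :
    ¬ σ.IsIrreducible := by
  refine not_isIrreducible_of_forall_apply_eq_smul σ (Pi.single 1 1) (by simp) (span_single_ne_top 1) fun g => ?_
  refine ⟨ρ g 1 1, ?_⟩
  rw [hσ]
  ext i
  fin_cases i <;> simp [mulVec, dotProduct, Fin.sum_univ_two, h g]

/-- **Matrix form (lower-left entries vanish).** If `ρ(g)₁₀ = 0` for all `g`, then `e₁` is a common eigenvector and `σ`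
is not irreducible. [folklore] -/
theorem not_isIrreducible_of_apply_one_zero_eq_zero (σ : Representation K G (Fin 2 → K))
    (ρ : G → Matrix (Fin 2) (Fin 2) K) (hσ : ∀ g v, σ g v = ρ g *ᵥ v) (h : ∀ g, ρ g 1 0 = 0) :
    ¬ σ.IsIrreducible := by
  refine not_isIrreducible_of_forall_apply_eq_smul σ (Pi.single 0 1) (by simp) (span_single_ne_top 0) fun g => ?_
  refine ⟨ρ g 0 0, ?_⟩
  rw [hσ]
  ext i
  fin_cases i <;> simp [mulVec, dotProduct, Fin.sum_univ_two, h g]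

/-- **Non-degeneracy of Wiles' `x` at an irreducible fibre.** If the products `ρ(r)₀₁ · ρ(s)₁₀` — Wiles' `x(r, s)` for a
representation read in a `c`-adapted frame — vanish for ALL `r, s`, then (over a field) either every `ρ(r)₀₁` or every
`ρ(s)₁₀` vanishes, so `σ` has a stable coordinate line and is not irreducible. Contrapositive: an irreducible
two-dimensional representation has `x(r₀, s₀) ≠ 0` for some pair. [folklore; cf. Hida, *MFG*, proof of Prop. 2.16] -/
theorem not_isIrreducible_of_offDiag_mul_eq_zero (σ : Representation K G (Fin 2 → K))
    (ρ : G → Matrix (Fin 2) (Fin 2) K) (hσ : ∀ g v, σ g v = ρ g *ᵥ v) (h : ∀ r s, ρ r 0 1 * ρ s 1 0 = 0) :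
    ¬ σ.IsIrreducible := by
  by_cases h01 : ∀ r, ρ r 0 1 = 0
  · exact not_isIrreducible_of_apply_zero_one_eq_zero σ ρ hσ h01
  · push Not at h01
    obtain ⟨r, hr⟩ := h01
    exact not_isIrreducible_of_apply_one_zero_eq_zero σ ρ hσ fun s => (mul_eq_zero.mp (h r s)).resolve_left hr

/-- The same with the conclusion as an existence statement: an irreducible `σ` acting through `ρ` has a pair `(r₀, s₀)`
with `ρ(r₀)₀₁ · ρ(s₀)₁₀ ≠ 0`. [folklore] -/
theorem exists_offDiag_mul_ne_zero_of_isIrreducible (σ : Representation K G (Fin 2 → K))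
    (ρ : G → Matrix (Fin 2) (Fin 2) K) (hσ : ∀ g v, σ g v = ρ g *ᵥ v) (hirr : σ.IsIrreducible) :
    ∃ r s, ρ r 0 1 * ρ s 1 0 ≠ 0 := by
  by_contra h
  push Not at h
  exact not_isIrreducible_of_offDiag_mul_eq_zero σ ρ hσ h hirr

end Reducible

/-! ### §2. Rigidity of the trace pairing -/

section TraceRigidity

variable {A : Type*} [CommRing A] {n : Type*} [Fintype n] [DecidableEq n]

/-- **Non-degeneracy of the trace pairing.** If a set `S` of matrices SPANS `Mₙ(A)` and `tr(s M) = tr(s N)` for every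
`s ∈ S`, then `M = N`. [folklore] -/
theorem eq_of_forall_trace_mul_eq {S : Set (Matrix n n A)} (hS : Submodule.span A S = ⊤) (M N : Matrix n n A)
    (h : ∀ s ∈ S, (s * M).trace = (s * N).trace) : M = N := by
  refine Matrix.ext_iff_trace_mul_left.mpr fun x => ?_
  have hx : x ∈ Submodule.span A S := by rw [hS]; exact Submodule.mem_top
  refine Submodule.span_induction (p := fun y _ => (y * M).trace = (y * N).trace) ?_ ?_ ?_ ?_ hx
  · exact h
  · rw [zero_mul, zero_mul]
  · intro y z _ _ hy hz
    rw [add_mul, add_mul, trace_add, trace_add, hy, hz]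
  · intro a y _ hy
    rw [smul_mul_assoc, smul_mul_assoc, trace_smul, trace_smul, hy]

/-- **`tr(ρ(g) M) = tr(ρ(g))` for a spanning family forces `M = 1`** — the shape in which unramifiedness of an
interpolated representation is deduced from the fibrewise identities `T(σι) = T(σ)`. [folklore] -/
theorem eq_one_of_forall_trace_mul_eq {ι : Type*} (ρ : ι → Matrix n n A)
    (hS : Submodule.span A (Set.range ρ) = ⊤) (M : Matrix n n A) (h : ∀ i, (ρ i * M).trace = (ρ i).trace) :
    M = 1 := by
  refine eq_of_forall_trace_mul_eq hS M 1 ?_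
  rintro _ ⟨i, rfl⟩
  rw [mul_one, h i]

/-- For a MONOID homomorphism `ρ : G →* Mₙ(A)`, the `A`-span of its range is already a subalgebra (the range is a
submonoid), so «the `ρ(g)` generate `Mₙ(A)` as an `A`-algebra» implies «the `ρ(g)` span `Mₙ(A)`». [folklore] -/
theorem span_range_eq_top_of_adjoin_eq_top {G : Type*} [Monoid G] (ρ : G →* Matrix n n A)
    (h : Algebra.adjoin A (Set.range ρ) = ⊤) : Submodule.span A (Set.range ρ) = ⊤ := by
  have hclos : (Submonoid.closure (Set.range ρ) : Set (Matrix n n A)) = Set.range ρ := by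
    have : Submonoid.closure (Set.range ρ) = MonoidHom.mrange ρ := by
      rw [← MonoidHom.coe_mrange, Submonoid.closure_eq]
    rw [this, MonoidHom.coe_mrange]
  have e := Algebra.adjoin_eq_span (R := A) (Set.range ρ)
  rw [hclos, h] at e
  rw [← e]
  rfl

/-- **Unramifiedness transfer, matrix form.** For a monoid homomorphism `ρ : G →* Mₙ(A)` whose range generates `Mₙ(A)`
as an `A`-algebra, an element `ι ∈ G` with `tr ρ(g ι) = tr ρ(g)` for ALL `g` satisfies `ρ(ι) = 1`. [folklore; the
argument of Wiles 1988 §2.2 / Skinner–Wiles 1999 §3 for the Λ-adic representation off the level] -/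
theorem map_eq_one_of_forall_trace_mul_eq {G : Type*} [Monoid G] (ρ : G →* Matrix n n A)
    (h : Algebra.adjoin A (Set.range ρ) = ⊤) (ι : G) (hι : ∀ g, (ρ (g * ι)).trace = (ρ g).trace) : ρ ι = 1 :=
  eq_one_of_forall_trace_mul_eq ρ (span_range_eq_top_of_adjoin_eq_top ρ h) (ρ ι) fun g => by rw [← map_mul, hι]

end TraceRigidity

end Summit.BirchSwinnertonDyer.BirchSwinnertonDyer.Theorems.TelescopeBranchWilesRepAlgebra
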